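import Summits.HubbardSuperconductivity.HubbardSuperconductivity.Theorems.TwTipContinuation.Negative.AbstractTipShapeFalse

/-!
# `TwTipContinuation` (stmt-HubbardSuperconductivity-1700) — even g-UNIFORM rungs do not give EVERY-GS order
# at the corner for abstract seeded families (negative-side support, cdisprove gen 3)

Route `ThermalWedge`, crux rank 6. Companion of `Negative/AbstractTipShapeFalse.lean` (level crossing
INSIDE `(0, 1/20)`: the Tip-shape is false for abstract families) and of `Negative/CornerDanskin.lean`
(positive side, Danskin by compactness: g-uniform rungs DO give SOME ordered ground state of the pure
torus). Here the crossing sits exactly AT the corner `g = 0`: for the two-level family `A₀ − gP` with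
`A₀ = 0` and `P = diag(0, 40) ≥ 0`, EVERY unit minimiser at EVERY seed `g > 0` has `⟨P⟩ = 40` (one
constant for all small seeds — the strongest conclusion any `g > 0` engine can deliver: `CornerPersistence`,
`TwSeededRung` with `∀K`, "no quantum phase transition as `g ↓ 0`"), yet at `g = 0` the dark level `e₀`
(`⟨P⟩ = 0`) is a ground state next to the ordered one. So "g-uniform every-GS order on `(0, 1/10]` ⇒
every-GS order at `0`" is FALSE without model-specific input; what survives abstractly is only the
`∃`-GS conclusion. In the many-body problem this is the scenario "an exactly degenerate competing
ground state of the pure torus at the chosen `(U, δ, L)`".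

* `not_abstractUniformRungsShape` — `¬ ∀ (A P : Matrix (Fin 2) (Fin 2) ℝ), P.PosSemidef →
  (∀ g ∈ (0, 1/10], every unit minimiser `v` of `⟨v,(A − gP)v⟩` has `1 ≤ ⟨v,Pv⟩`) →
  (every unit minimiser of `⟨v,Av⟩` has `0 < ⟨v,Pv⟩`)`.

Elementary linear algebra; folklore.
-/

namespace Summit.HubbardSuperconductivity.TwTipContinuation.Negative

open Matrix

/-- `⟨v, (0 − gP) v⟩ = −40 g v₁²` for `P = diag(0,40)`. [folklore] -/
theorem toy₀_form (g : ℝ) (v : Fin 2 → ℝ) :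
    v ⬝ᵥ ((0 : Matrix (Fin 2) (Fin 2) ℝ) - g • Matrix.diagonal ![(0 : ℝ), 40]) *ᵥ v =
      -(40 * g) * v 1 ^ 2 := by
  simp [Matrix.mulVec, dotProduct, Fin.sum_univ_two, Matrix.diagonal, Matrix.sub_apply]
  ring

/-- **The uniform-rungs shape is FALSE for abstract seeded families** (exact level crossing AT `g = 0`):
with `A₀ = 0`, `P = diag(0,40)`, every unit minimiser of `⟨v,(A₀ − gP)v⟩` has `⟨v,Pv⟩ = 40 ≥ 1` for
EVERY `g > 0`, while the unit minimiser `e₀` of `⟨v,A₀v⟩` has `⟨v,Pv⟩ = 0`. Hence no hypothesis on the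
seeded family at `g > 0` — however uniform in `g` — yields the every-GS order of the crux's conclusion by
bookkeeping; only an `∃`-GS conclusion survives (`existsGSOrder_pure_of_uniformRungs`). [folklore] -/
theorem not_abstractUniformRungsShape :
    ¬ (∀ (A P : Matrix (Fin 2) (Fin 2) ℝ), P.PosSemidef →
        (∀ g : ℝ, 0 < g → g ≤ 1 / 10 → ∀ v : Fin 2 → ℝ, (v ⬝ᵥ v = 1 ∧ ∀ w : Fin 2 → ℝ, w ⬝ᵥ w = 1 →
            v ⬝ᵥ (A - g • P) *ᵥ v ≤ w ⬝ᵥ (A - g • P) *ᵥ w) →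
          1 ≤ v ⬝ᵥ P *ᵥ v) →
        ∀ v : Fin 2 → ℝ, (v ⬝ᵥ v = 1 ∧ ∀ w : Fin 2 → ℝ, w ⬝ᵥ w = 1 → v ⬝ᵥ A *ᵥ v ≤ w ⬝ᵥ A *ᵥ w) →
          0 < v ⬝ᵥ P *ᵥ v) := by
  intro h
  have hP : (Matrix.diagonal ![(0 : ℝ), 40]).PosSemidef :=
    Matrix.PosSemidef.diagonal (by intro i; fin_cases i <;> simp)
  -- uniform rungs: lit with `⟨P⟩ = 40` at every seed `g > 0`
  have hlit : ∀ g : ℝ, 0 < g → g ≤ 1 / 10 → ∀ v : Fin 2 → ℝ, (v ⬝ᵥ v = 1 ∧ ∀ w : Fin 2 → ℝ, w ⬝ᵥ w = 1 →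
      v ⬝ᵥ ((0 : Matrix (Fin 2) (Fin 2) ℝ) - g • Matrix.diagonal ![(0 : ℝ), 40]) *ᵥ v ≤
        w ⬝ᵥ ((0 : Matrix (Fin 2) (Fin 2) ℝ) - g • Matrix.diagonal ![(0 : ℝ), 40]) *ᵥ w) →
      1 ≤ v ⬝ᵥ Matrix.diagonal ![(0 : ℝ), 40] *ᵥ v := by
    rintro g hg - v ⟨hn, hmin⟩
    have h1 := hmin ![0, 1] (by simp [dotProduct, Fin.sum_univ_two])
    rw [toy₀_form, toy₀_form] at h1
    rw [toy_norm] at hn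
    rw [toy_formP]
    simp at h1
    nlinarith
  -- dark at the corner: `e₀` is a ground state of `A₀ = 0` with `⟨P⟩ = 0`
  have hgs : (![1, 0] : Fin 2 → ℝ) ⬝ᵥ ![1, 0] = 1 ∧ ∀ w : Fin 2 → ℝ, w ⬝ᵥ w = 1 →
      ![1, 0] ⬝ᵥ (0 : Matrix (Fin 2) (Fin 2) ℝ) *ᵥ ![1, 0] ≤ w ⬝ᵥ (0 : Matrix (Fin 2) (Fin 2) ℝ) *ᵥ w := by
    refine ⟨by simp [dotProduct, Fin.sum_univ_two], fun w _ => ?_⟩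
    simp
  have := h _ _ hP hlit ![1, 0] hgs
  rw [toy_formP] at this
  simp at this

end Summit.HubbardSuperconductivity.TwTipContinuation.Negative
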